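import Summits.QuantumFields.YangMills.Theorems.BalabanUVNodesN08HaarCompatibilityGuardCrossingLaw
import Summits.QuantumFields.YangMills.Theorems.BalabanUVNodesN08HaarCompatibilityGuardCrossingPrivacy

/-!
# BalabanUVNodes ∕ N08 — THE CONJUGATED CROSSING LOOP VARIABLES ARE I.I.D. HAAR JOINTLY OVER ALL COARSE BONDS:
# `Law_{dU}((R̃_{c,r})_{c, r}) = Haar^{Σ_c T_c}`, hence `dU{∀ c ∈ S, Small ℰ · c} ≤ Haar{dist1 < δ}^{|S|·(L^{d−1}−1)}`

WIDTH SEAT `pub-ymgap-dag-n08-w3` g4, `W-SEAT-START-LIST.md` v10 §0 (iii); item-3 lineage part 18 = part 7B (p596721: ONE coarse bond) made JOINT over all coarse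
bonds with part 17 (`…GuardCrossingPrivacy`: the crossing bonds of `c` lie on no loop ∕ axis of `c′ ≠ c`), 2026-08-28.  DAG node N08 = [Balaban1985UV3]
Thm 1 p. 257 (compact) + Thm 2 p. 272; key item K1⁷ `StabilityBAtRecordR13SepCoPH` (stmt-QuantumFields-20542), `--supports … --as helper`.  COUNT-NEUTRAL.

THE POINT.  Part 7B conjugated the `#T = L^{d−1} − 1` off-axis crossing loop variables of ONE coarse bond into an i.i.d. Haar family under `dU` (the
multi-shear at the bond's private crossing bonds + Weil uniqueness, `map_eq_pi_haar_of_mulRight`).  With part 17's privacy ACROSS bonds the same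
multi-shear runs over the crossing bonds of ALL coarse bonds at once:
* §1 `exists_conj_family_all` — a measurable family `Z U ⟨c, r⟩`, `c ∈ PBond(j+1)`, `r ∈ T_c` (non-central transverse offsets), each a conjugate of the
  loop variable of `c` of index `(r, 1, 1)`, right-translated coordinatewise by the TOTAL multi-shear `U ↦ U·(k ∘ q⁻¹)` over all crossing bonds
  (`q` injective over `Σ_c T_c`: part 17 `ne_of_cross_eq_cross` + part 7A `cross_injective`); ★★★ `map_conj_family_all_eq_pi` —
  **`Law_{dU}(Z) = Haar^{Σ_c T_c}`: the conjugated crossing loop variables of ALL coarse bonds are JOINTLY i.i.d. Haar.**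
* §2 consequences by product sets: ★★ `measure_forall_small_le_pow` — **`dU{U | ∀ c ∈ S, Small ℰ U c} ≤ Haar{dist1 < δ}^{Σ_{c∈S} #T_c} = h^{|S|·(L^{d−1}−1)}`**
  for every finset `S` of coarse bonds (part 7B is `|S| = 1`; a union bound cannot give products) — the simultaneous small-field probability of the typed
  (0.4) guard FACTORISES as if the guards of distinct coarse bonds were independent; at the slot `avOfPrint N S j` on `SU(N)`, every `N`.

LOCATED USE (not typed here).  The joint law is the input of the INDEPENDENCE across `c` of ANY events measurable in the blocks `(Z_{c,r})_r` (e.g.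
`E_c = {R̃_{c,·} pairwise 2δ-close} ⊇ {guard-admitting at c}`), hence of `E_U Π_c(1 + (K−1)1[ga_c]) ≤ (1 + (K−1)s)^{#PBond(j+1)}` in parts 14∕16's one-step
bound — the block factorisation of `Haar^{Σ_c T_c}` (next piece).

HONEST FRAMING.  [folklore] measure theory + lattice combinatorics about the printed loop words of (0.4); nothing of Bałaban's asserted; E6′ NOT decided;
`hmass` NOT supplied; count-neutral; N08 NOT discharged; counts unmoved (typed 28∕28 · discharged 5∕27); one finite 𝕋⁴ programme at fixed ε — R4 closes the
CONDITIONAL rung `BalabanLadder.UV` only; the Yang–Mills mass gap (Clay) is NOT proved; nothing continuum ∕ OS.  0 `sorry`, 0 `def`, standard axioms.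
-/

noncomputable section

open MeasureTheory Function

namespace Summit.QuantumFields.YangMills.BalabanUVNodes.N08HaarCompatibilityGuardCrossingJointLaw

open Literature.MathematicalPhysics.QuantumFieldTheory.Balaban1983to89
open Literature.MathematicalPhysics.QuantumFieldTheory.Balaban1983to89.T4Continuum
open Literature.MathematicalPhysics.QuantumFieldTheory.Balaban1983to89.T4ReflectionCone (netDisp_append netDisp_replicate holAt_congr)
open Literature.MathematicalPhysics.QuantumFieldTheory.Balaban1983to89.AveragingRT (axialAvg measurable_axialAvg two_mul_half_add_one)
open Literature.MathematicalPhysics.QuantumFieldTheory.Balaban1983to89.BlockAveraging (Idx off off_bounds loopHol Small measurable_loopHol)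
open Literature.MathematicalPhysics.QuantumFieldTheory.Balaban1983to89.BlockAveragingHaarAC
  (IsCentral flip_mem_walk_of_mem_walk_wordRev)
open Summit.QuantumFields.YangMills.BalabanUVNodes.N08HaarCompatibilityGuardCrossing
  (cross_dir cross_src_apply cross_injective replicate_split loopHol_eq_mul_apply_cross_mul holAt_mulRight_extend_of_forall_ne ne_cross_of_mem_walk_stairWord
    ne_cross_of_mem_walk_wordRev_stairWord ne_cross_of_mem_walk_axis ne_cross_of_mem_walk_prefix ne_cross_of_mem_walk_suffix)
open Summit.QuantumFields.YangMills.BalabanUVNodes.N08HaarCompatibilityGuardCrossingLaw (map_eq_pi_haar_of_mulRight card_offsets)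
open Summit.QuantumFields.YangMills.BalabanUVNodes.N08HaarCompatibilityGuardCrossingPrivacy
  (ne_face_of_mem_walk_stairWord eq_of_mem_walk_replicate_of_eq_face eq_of_mem_walk_line_of_eq_face cross_src_apply_face ne_of_cross_eq_cross)

variable {P : Params} {j : ℕ}

/-! ## §1 The total crossing family and the joint law -/

section Joint

variable {G : Type*} [GaugeGroup G]

/-- **EVERY PIECE OF THE LOOP `(r, 1, 1)` OF `c` AVOIDS EVERY CROSSING BOND OF EVERY COARSE BOND** — staircase, first half-segment, second half-segment, reversed
staircase, axis: for the own bond `c` by part 7A, for `c′ ≠ c` by part 17's face-bond analysis (standing range; plumbing for the total multi-shear). [folklore] -/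
theorem forall_ne_crossAll (hj : j + 1 ≤ P.m + P.K) (c : PBond P (j + 1)) (r : {r : Fin P.d → Fin P.L // off r c.dir = 0 ∧ ¬ IsCentral c (r, 1, 1)})
    (σ' : (c' : PBond P (j + 1)) × {r : Fin P.d → Fin P.L // off r c'.dir = 0 ∧ ¬ IsCentral c' (r, 1, 1)}) (s : LStep P j)
    (hs : s ∈ walk (emb c.src) (stairWord 1 (off r.1)) ∨
      s ∈ walk (walkEnd (emb c.src) (stairWord 1 (off r.1))) (List.replicate ((P.L - 1) / 2) (c.dir, true)) ∨
      s ∈ walk (walkEnd (emb c.src) (stairWord 1 (off r.1) ++ List.replicate ((P.L - 1) / 2 + 1) (c.dir, true)))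
        (List.replicate (P.L - 1 - (P.L - 1) / 2) (c.dir, true)) ∨
      s ∈ walk (walkEnd (walkEnd (emb c.src) (stairWord 1 (off r.1))) (List.replicate P.L (c.dir, true))) (wordRev (stairWord 1 (off r.1))) ∨
      s ∈ walk (emb c.src) (List.replicate P.L (c.dir, true))) :
    s.bond ≠ (⟨walkEnd (emb σ'.1.src) (stairWord 1 (off σ'.2.1) ++ List.replicate ((P.L - 1) / 2) (σ'.1.dir, true)), σ'.1.dir⟩ : PBond P j) := by
  obtain ⟨c', r'⟩ := σ'
  have hL := two_mul_half_add_one P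
  -- the crossing family of `c'` BY NAME (hypothesis shape of parts 7A∕17)
  have hqv' : ∀ ρ : {r : Fin P.d → Fin P.L // off r c'.dir = 0 ∧ ¬ IsCentral c' (r, 1, 1)},
      (fun ρ : {r : Fin P.d → Fin P.L // off r c'.dir = 0 ∧ ¬ IsCentral c' (r, 1, 1)} =>
          (⟨walkEnd (emb c'.src) (stairWord 1 (off ρ.1) ++ List.replicate ((P.L - 1) / 2) (c'.dir, true)), c'.dir⟩ : PBond P j)) ρ =
        ⟨walkEnd (emb c'.src) (stairWord 1 (off ((fun ρ : {r : Fin P.d → Fin P.L // off r c'.dir = 0 ∧ ¬ IsCentral c' (r, 1, 1)} => ρ.1) ρ)) ++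
          List.replicate ((P.L - 1) / 2) (c'.dir, true)), c'.dir⟩ := fun _ => rfl
  have h0' : ∀ ρ : {r : Fin P.d → Fin P.L // off r c'.dir = 0 ∧ ¬ IsCentral c' (r, 1, 1)},
      off ((fun ρ : {r : Fin P.d → Fin P.L // off r c'.dir = 0 ∧ ¬ IsCentral c' (r, 1, 1)} => ρ.1) ρ) c'.dir = 0 := fun ρ => ρ.2.1
  by_cases hcc : c' = c
  · -- own bond: part 7A
    subst hcc
    show s.bond ≠ (fun ρ : {r : Fin P.d → Fin P.L // off r c'.dir = 0 ∧ ¬ IsCentral c' (r, 1, 1)} =>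
      (⟨walkEnd (emb c'.src) (stairWord 1 (off ρ.1) ++ List.replicate ((P.L - 1) / 2) (c'.dir, true)), c'.dir⟩ : PBond P j)) r'
    rcases hs with hs | hs | hs | hs | hs
    · exact ne_cross_of_mem_walk_stairWord c' _ _ hqv' (h0' r) 1 _ hs r'
    · exact ne_cross_of_mem_walk_prefix c' _ _ hqv' h0' hj r hs r'
    · exact ne_cross_of_mem_walk_suffix c' _ _ hqv' h0' hj r hs r'
    · exact ne_cross_of_mem_walk_wordRev_stairWord c' _ _ hqv' (h0' r) 1 _ hs r'
    · exact ne_cross_of_mem_walk_axis c' _ _ hqv' hj r'.2.2 hs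
  · -- another bond: part 17's face-bond analysis at the face bond of `B(c'₋)` with transverse offsets `off r'`
    have hbdir := cross_dir c' _ _ hqv' r'
    have hbsrc := cross_src_apply_face c' _ _ hqv' h0' r'
    have hn := off_bounds r.1
    intro hsb
    rcases hs with hs | hs | hs | hs | hs
    · exact ne_face_of_mem_walk_stairWord c'.src c'.dir (off r'.1) hbdir hbsrc hj c.src 1 (off r.1) hn hs hsb
    · -- first half of the segment ⊆ the segment
      have hx : ∀ ν, walkEnd (emb c.src) (stairWord 1 (off r.1)) ν = emb c.src ν + ((off r.1 ν : ℤ) : ZMod (P.sitesPerDir j)) :=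
        fun ν => by rw [walkEnd_apply, netDisp_stairWord]
      have hs' : s ∈ walk (walkEnd (emb c.src) (stairWord 1 (off r.1))) (List.replicate P.L (c.dir, true)) := by
        rw [replicate_split (P := P) c.dir, walk_append, List.mem_append]; exact Or.inl hs
      obtain ⟨hy, hd, -⟩ := eq_of_mem_walk_replicate_of_eq_face c'.src c'.dir (off r'.1) (off_bounds r'.1) hbdir hbsrc hj c.src c.dir (off r.1) hn hx hs' hsb
      exact hcc (by cases c; cases c'; simp only at hy hd; subst hy; subst hd; rfl)
    · -- second half of the segment ⊆ the segment
      have hx : ∀ ν, walkEnd (emb c.src) (stairWord 1 (off r.1)) ν = emb c.src ν + ((off r.1 ν : ℤ) : ZMod (P.sitesPerDir j)) :=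
        fun ν => by rw [walkEnd_apply, netDisp_stairWord]
      have e : walkEnd (emb c.src) (stairWord 1 (off r.1) ++ List.replicate ((P.L - 1) / 2 + 1) (c.dir, true)) =
          (walkEnd (walkEnd (emb c.src) (stairWord 1 (off r.1))) (List.replicate ((P.L - 1) / 2) (c.dir, true))).shift c.dir := by
        rw [walkEnd_append, List.replicate_succ', walkEnd_append]; rfl
      have hs' : s ∈ walk (walkEnd (emb c.src) (stairWord 1 (off r.1))) (List.replicate P.L (c.dir, true)) := by
        rw [replicate_split (P := P) c.dir, walk_append, List.mem_append, walk, List.mem_cons, ← e]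
        exact Or.inr (Or.inr hs)
      obtain ⟨hy, hd, -⟩ := eq_of_mem_walk_replicate_of_eq_face c'.src c'.dir (off r'.1) (off_bounds r'.1) hbdir hbsrc hj c.src c.dir (off r.1) hn hx hs' hsb
      exact hcc (by cases c; cases c'; simp only at hy hd; subst hy; subst hd; rfl)
    · -- the reversed staircase is a staircase from `emb c₊`
      have hstart : walkEnd (walkEnd (emb c.src) (stairWord 1 (off r.1))) (List.replicate P.L (c.dir, true)) = walkEnd (emb c.tgt) (stairWord 1 (off r.1)) := by
        funext ν
        rw [walkEnd_apply, walkEnd_apply, walkEnd_apply, PBond.tgt, emb_shift_apply, netDisp_stairWord, netDisp_replicate]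
        by_cases hν : ν = c.dir
        · subst hν; simp only [if_true, mul_one]; push_cast; ring
        · simp [hν, Ne.symm hν]
      rw [hstart] at hs
      exact ne_face_of_mem_walk_stairWord c'.src c'.dir (off r'.1) hbdir hbsrc hj c.tgt 1 (off r.1) hn (s := ⟨s.bond, !s.fwd⟩)
        (flip_mem_walk_of_mem_walk_wordRev _ _ s hs) hsb
    · obtain ⟨hc, -⟩ := eq_of_mem_walk_line_of_eq_face c'.src c'.dir (off r'.1) (off_bounds r'.1) hbdir hbsrc hj c hs hsb
      exact hcc (by rw [hc])

/-- **THE TOTAL CROSSING FAMILY IS INJECTIVE**: crossing bonds of distinct coarse bonds are distinct (part 17), of distinct offsets of one bond too (part 7A). [folklore] -/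
theorem crossAll_injective (hj : j + 1 ≤ P.m + P.K) :
    Function.Injective fun σ : (c : PBond P (j + 1)) × {r : Fin P.d → Fin P.L // off r c.dir = 0 ∧ ¬ IsCentral c (r, 1, 1)} =>
      (⟨walkEnd (emb σ.1.src) (stairWord 1 (off σ.2.1) ++ List.replicate ((P.L - 1) / 2) (σ.1.dir, true)), σ.1.dir⟩ : PBond P j) := by
  rintro ⟨c, r⟩ ⟨c', r'⟩ h
  have hqv : ∀ ρ : {r : Fin P.d → Fin P.L // off r c.dir = 0 ∧ ¬ IsCentral c (r, 1, 1)},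
      (fun ρ : {r : Fin P.d → Fin P.L // off r c.dir = 0 ∧ ¬ IsCentral c (r, 1, 1)} =>
          (⟨walkEnd (emb c.src) (stairWord 1 (off ρ.1) ++ List.replicate ((P.L - 1) / 2) (c.dir, true)), c.dir⟩ : PBond P j)) ρ =
        ⟨walkEnd (emb c.src) (stairWord 1 (off ((fun ρ : {r : Fin P.d → Fin P.L // off r c.dir = 0 ∧ ¬ IsCentral c (r, 1, 1)} => ρ.1) ρ)) ++
          List.replicate ((P.L - 1) / 2) (c.dir, true)), c.dir⟩ := fun _ => rfl
  have hqv' : ∀ ρ : {r : Fin P.d → Fin P.L // off r c'.dir = 0 ∧ ¬ IsCentral c' (r, 1, 1)},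
      (fun ρ : {r : Fin P.d → Fin P.L // off r c'.dir = 0 ∧ ¬ IsCentral c' (r, 1, 1)} =>
          (⟨walkEnd (emb c'.src) (stairWord 1 (off ρ.1) ++ List.replicate ((P.L - 1) / 2) (c'.dir, true)), c'.dir⟩ : PBond P j)) ρ =
        ⟨walkEnd (emb c'.src) (stairWord 1 (off ((fun ρ : {r : Fin P.d → Fin P.L // off r c'.dir = 0 ∧ ¬ IsCentral c' (r, 1, 1)} => ρ.1) ρ)) ++
          List.replicate ((P.L - 1) / 2) (c'.dir, true)), c'.dir⟩ := fun _ => rfl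
  have hcc : c = c' := ne_of_cross_eq_cross c _ _ hqv hj c' _ _ hqv' (i := r) (i' := r') h
  subst hcc
  have hrr : r = r' := cross_injective c _ _ hqv hj Subtype.val_injective h
  subst hrr
  rfl

variable [MeasurableSpace G] [RegularGaugeGroup G]

/-- ★ **THE CONJUGATED CROSSING LOOP VARIABLES OF ALL COARSE BONDS AT ONCE**: a measurable family `Z U ⟨c, r⟩`, `r` the non-central transverse offsets of `c`,
each a CONJUGATE of the loop variable of `c` of index `(r, 1, 1)`, which the TOTAL multi-shear over the crossing bonds of all coarse bonds right-translates
coordinatewise (standing range). [cite: Balaban1987RG1, (0.4) p.253 (bookkeeping)] -/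
theorem exists_conj_family_all (hj : j + 1 ≤ P.m + P.K) :
    ∃ Z : GaugeField P j G → ((c : PBond P (j + 1)) × {r : Fin P.d → Fin P.L // off r c.dir = 0 ∧ ¬ IsCentral c (r, 1, 1)}) → G,
      Measurable Z ∧ (∀ U σ, dist1 (Z U σ) = dist1 (loopHol U σ.1 (σ.2.1, 1, 1))) ∧
        ∀ (k : ((c : PBond P (j + 1)) × {r : Fin P.d → Fin P.L // off r c.dir = 0 ∧ ¬ IsCentral c (r, 1, 1)}) → G) (U : GaugeField P j G),
          Z (fun b => U b * Function.extend
              (fun σ : (c : PBond P (j + 1)) × {r : Fin P.d → Fin P.L // off r c.dir = 0 ∧ ¬ IsCentral c (r, 1, 1)} =>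
                (⟨walkEnd (emb σ.1.src) (stairWord 1 (off σ.2.1) ++ List.replicate ((P.L - 1) / 2) (σ.1.dir, true)), σ.1.dir⟩ : PBond P j))
              k (fun _ => 1) b) = fun σ => Z U σ * k σ := by
  -- the factors before and after the crossing bond in the loop `(r, 1, 1)` of `c`
  let X : GaugeField P j G → (c : PBond P (j + 1)) → (Fin P.d → Fin P.L) → G := fun V c r =>
    holAt V (walk (emb c.src) (stairWord 1 (off r))) *
      holAt V (walk (walkEnd (emb c.src) (stairWord 1 (off r))) (List.replicate ((P.L - 1) / 2) (c.dir, true)))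
  let Y : GaugeField P j G → (c : PBond P (j + 1)) → (Fin P.d → Fin P.L) → G := fun V c r =>
    holAt V (walk (walkEnd (emb c.src) (stairWord 1 (off r) ++ List.replicate ((P.L - 1) / 2 + 1) (c.dir, true)))
        (List.replicate (P.L - 1 - (P.L - 1) / 2) (c.dir, true))) *
      holAt V (walk (walkEnd (walkEnd (emb c.src) (stairWord 1 (off r))) (List.replicate P.L (c.dir, true))) (wordRev (stairWord 1 (off r)))) *
    (axialAvg V c)⁻¹
  refine ⟨fun U σ => Y U σ.1 σ.2.1 * loopHol U σ.1 (σ.2.1, 1, 1) * (Y U σ.1 σ.2.1)⁻¹, ?_, ?_, ?_⟩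
  · refine measurable_pi_lambda _ fun σ => ?_
    have hY : Measurable fun U : GaugeField P j G => Y U σ.1 σ.2.1 :=
      ((measurable_holAt _).mul (measurable_holAt _)).mul ((measurable_pi_apply σ.1).comp measurable_axialAvg).inv
    exact (hY.mul ((measurable_pi_apply _).comp (measurable_loopHol σ.1))).mul hY.inv
  · intro U σ
    exact GaugeGroup.dist1_conj _ _
  · intro k U
    funext σ
    obtain ⟨c, r⟩ := σ
    set q : ((c : PBond P (j + 1)) × {r : Fin P.d → Fin P.L // off r c.dir = 0 ∧ ¬ IsCentral c (r, 1, 1)}) → PBond P j :=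
      fun σ => ⟨walkEnd (emb σ.1.src) (stairWord 1 (off σ.2.1) ++ List.replicate ((P.L - 1) / 2) (σ.1.dir, true)), σ.1.dir⟩ with hq
    set V : GaugeField P j G := fun b => U b * Function.extend q k (fun _ => 1) b with hV
    -- the own-bond crossing family of `c` BY NAME
    have hqv : ∀ ρ : {r : Fin P.d → Fin P.L // off r c.dir = 0 ∧ ¬ IsCentral c (r, 1, 1)},
        (fun ρ : {r : Fin P.d → Fin P.L // off r c.dir = 0 ∧ ¬ IsCentral c (r, 1, 1)} => q ⟨c, ρ⟩) ρ =
          ⟨walkEnd (emb c.src) (stairWord 1 (off ((fun ρ : {r : Fin P.d → Fin P.L // off r c.dir = 0 ∧ ¬ IsCentral c (r, 1, 1)} => ρ.1) ρ)) ++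
            List.replicate ((P.L - 1) / 2) (c.dir, true)), c.dir⟩ := fun _ => rfl
    -- every piece of the loop avoids every crossing bond of every coarse bond
    have hne : ∀ s : LStep P j, (s ∈ walk (emb c.src) (stairWord 1 (off r.1)) ∨
        s ∈ walk (walkEnd (emb c.src) (stairWord 1 (off r.1))) (List.replicate ((P.L - 1) / 2) (c.dir, true)) ∨
        s ∈ walk (walkEnd (emb c.src) (stairWord 1 (off r.1) ++ List.replicate ((P.L - 1) / 2 + 1) (c.dir, true)))
          (List.replicate (P.L - 1 - (P.L - 1) / 2) (c.dir, true)) ∨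
        s ∈ walk (walkEnd (walkEnd (emb c.src) (stairWord 1 (off r.1))) (List.replicate P.L (c.dir, true))) (wordRev (stairWord 1 (off r.1))) ∨
        s ∈ walk (emb c.src) (List.replicate P.L (c.dir, true))) → ∀ σ', s.bond ≠ q σ' :=
      fun s hs σ' => forall_ne_crossAll hj c r σ' s hs
    have hX : X V c r.1 = X U c r.1 := by
      show _ * _ = _ * _
      rw [holAt_mulRight_extend_of_forall_ne q U k fun s hs σ' => hne s (Or.inl hs) σ',
        holAt_mulRight_extend_of_forall_ne q U k fun s hs σ' => hne s (Or.inr (Or.inl hs)) σ']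
    have hAx : axialAvg V c = axialAvg U c := by
      rw [axialAvg_eq_holAt_walk, axialAvg_eq_holAt_walk]
      exact holAt_mulRight_extend_of_forall_ne q U k fun s hs σ' => hne s (Or.inr (Or.inr (Or.inr (Or.inr hs)))) σ'
    have hY : Y V c r.1 = Y U c r.1 := by
      show _ * _ * _ = _ * _ * _
      rw [holAt_mulRight_extend_of_forall_ne q U k fun s hs σ' => hne s (Or.inr (Or.inr (Or.inl hs))) σ',
        holAt_mulRight_extend_of_forall_ne q U k fun s hs σ' => hne s (Or.inr (Or.inr (Or.inr (Or.inl hs)))) σ', hAx]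
    have hVq : V (q ⟨c, r⟩) = U (q ⟨c, r⟩) * k ⟨c, r⟩ := by
      show U _ * Function.extend q k (fun _ => 1) (q ⟨c, r⟩) = _
      rw [(crossAll_injective (P := P) hj).extend_apply]
    -- the loop factorises through its crossing bond (part 7A), for `V` and for `U`
    have hloopV := loopHol_eq_mul_apply_cross_mul c _ (fun ρ => q ⟨c, ρ⟩) hqv V r
    have hloopU := loopHol_eq_mul_apply_cross_mul c _ (fun ρ => q ⟨c, ρ⟩) hqv U r
    show Y V c r.1 * loopHol V c (r.1, 1, 1) * (Y V c r.1)⁻¹ = Y U c r.1 * loopHol U c (r.1, 1, 1) * (Y U c r.1)⁻¹ * k ⟨c, r⟩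
    rw [hloopV, hloopU]
    show Y V c r.1 * (X V c r.1 * V (q ⟨c, r⟩) * Y V c r.1) * (Y V c r.1)⁻¹ = Y U c r.1 * (X U c r.1 * U (q ⟨c, r⟩) * Y U c r.1) * (Y U c r.1)⁻¹ * k ⟨c, r⟩
    rw [hY, hX, hVq]
    group

variable [HaarData G]

/-- ★★★ **THE CONJUGATED CROSSING LOOP VARIABLES OF ALL COARSE BONDS ARE JOINTLY I.I.D. HAAR**: `Law_{dU}(Z) = Haar^{Σ_c T_c}` (part 7B's
`map_eq_pi_haar_of_mulRight` on the total family; standing range, every group). [cite: Balaban1987RG1, (0.4) p.253 (bookkeeping)] -/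
theorem map_conj_family_all_eq_pi (hj : j + 1 ≤ P.m + P.K) :
    ∃ Z : GaugeField P j G → ((c : PBond P (j + 1)) × {r : Fin P.d → Fin P.L // off r c.dir = 0 ∧ ¬ IsCentral c (r, 1, 1)}) → G,
      Measurable Z ∧ (∀ U σ, dist1 (Z U σ) = dist1 (loopHol U σ.1 (σ.2.1, 1, 1))) ∧
        (fieldMeasure P j G).map Z =
          Measure.pi fun _ : (c : PBond P (j + 1)) × {r : Fin P.d → Fin P.L // off r c.dir = 0 ∧ ¬ IsCentral c (r, 1, 1)} =>
            (HaarData.haar : Measure G) := by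
  obtain ⟨Z, hZm, hdist, hshear⟩ := exists_conj_family_all (G := G) hj
  exact ⟨Z, hZm, hdist, map_eq_pi_haar_of_mulRight _ Z hZm hshear⟩

/-! ## §2 The simultaneous small-field probability of a set of coarse bonds is a product -/

/-- ★★ **THE SIMULTANEOUS SMALLNESS OF THE CROSSING LOOPS OF A SET OF COARSE BONDS IS A PRODUCT**: for every radius `ρ` and finset `S`,
`dU{U | ∀ c ∈ S, ∀ r ∈ T_c, dist1(U(loop_{c,(r,1,1)})) < ρ} ≤ Π_{c∈S} Haar{dist1 < ρ}^{#T_c}` — the conjugated crossing loops are jointly i.i.d. Haar and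
`dist1` is conjugation invariant (box computation `Measure.pi_pi` on `Σ_c T_c`). [cite: Balaban1987RG1, (0.4) p.253 (bookkeeping)] -/
theorem measure_forall_crossLoops_lt_le_prod (hj : j + 1 ≤ P.m + P.K) (ρ : ℝ) (S : Finset (PBond P (j + 1))) :
    fieldMeasure P j G {U : GaugeField P j G | ∀ c ∈ S, ∀ r : {r : Fin P.d → Fin P.L // off r c.dir = 0 ∧ ¬ IsCentral c (r, 1, 1)},
        dist1 (loopHol U c (r.1, 1, 1)) < ρ} ≤
      ∏ c ∈ S, HaarData.haar {g : G | dist1 g < ρ} ^ Fintype.card {r : Fin P.d → Fin P.L // off r c.dir = 0 ∧ ¬ IsCentral c (r, 1, 1)} := by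
  classical
  obtain ⟨Z, hZm, hdist, hlaw⟩ := map_conj_family_all_eq_pi (G := G) hj
  haveI := HaarData.isProb (G := G)
  have hball : MeasurableSet {g : G | dist1 g < ρ} := measurableSet_lt RegularGaugeGroup.measurable_dist1 measurable_const
  -- the box: `ρ`-ball at the coordinates of `S`, everything elsewhere
  let B : ((c : PBond P (j + 1)) × {r : Fin P.d → Fin P.L // off r c.dir = 0 ∧ ¬ IsCentral c (r, 1, 1)}) → Set G :=
    fun σ => if σ.1 ∈ S then {g : G | dist1 g < ρ} else Set.univ
  have hB : ∀ σ, MeasurableSet (B σ) := fun σ => by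
    by_cases h : σ.1 ∈ S <;> simp only [B, h, if_true, if_false, hball, MeasurableSet.univ]
  have hsub : {U : GaugeField P j G | ∀ c ∈ S, ∀ r : {r : Fin P.d → Fin P.L // off r c.dir = 0 ∧ ¬ IsCentral c (r, 1, 1)},
      dist1 (loopHol U c (r.1, 1, 1)) < ρ} ⊆ Z ⁻¹' Set.pi Set.univ B := by
    intro U hU σ _
    by_cases h : σ.1 ∈ S
    · simp only [B, h, if_true, Set.mem_setOf_eq]
      rw [hdist]
      exact hU σ.1 h σ.2
    · simp only [B, h, if_false, Set.mem_univ]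
  calc fieldMeasure P j G {U : GaugeField P j G | ∀ c ∈ S, ∀ r : {r : Fin P.d → Fin P.L // off r c.dir = 0 ∧ ¬ IsCentral c (r, 1, 1)},
        dist1 (loopHol U c (r.1, 1, 1)) < ρ}
      ≤ fieldMeasure P j G (Z ⁻¹' Set.pi Set.univ B) := measure_mono hsub
    _ = (fieldMeasure P j G).map Z (Set.pi Set.univ B) := (Measure.map_apply hZm (MeasurableSet.univ_pi hB)).symm
    _ = ∏ σ, HaarData.haar (B σ) := by rw [hlaw, Measure.pi_pi]
    _ = ∏ σ : (c : PBond P (j + 1)) × {r : Fin P.d → Fin P.L // off r c.dir = 0 ∧ ¬ IsCentral c (r, 1, 1)},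
          (if σ.1 ∈ S then HaarData.haar {g : G | dist1 g < ρ} else 1) := by
        refine Finset.prod_congr rfl fun σ _ => ?_
        by_cases h : σ.1 ∈ S
        · simp only [B, h, if_true]
        · simp only [B, h, if_false, measure_univ]
    _ = ∏ c ∈ S, HaarData.haar {g : G | dist1 g < ρ} ^ Fintype.card {r : Fin P.d → Fin P.L // off r c.dir = 0 ∧ ¬ IsCentral c (r, 1, 1)} := by
        rw [← Finset.univ_sigma_univ, Finset.prod_sigma]
        rw [← Finset.prod_filter_mul_prod_filter_not Finset.univ (fun c => c ∈ S)]
        have h1 : ∏ c ∈ Finset.univ.filter (fun c : PBond P (j + 1) => c ∈ S),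
            ∏ _r : {r : Fin P.d → Fin P.L // off r c.dir = 0 ∧ ¬ IsCentral c (r, 1, 1)},
              (if c ∈ S then HaarData.haar {g : G | dist1 g < ρ} else (1 : ENNReal)) =
            ∏ c ∈ S, HaarData.haar {g : G | dist1 g < ρ} ^ Fintype.card {r : Fin P.d → Fin P.L // off r c.dir = 0 ∧ ¬ IsCentral c (r, 1, 1)} := by
          rw [Finset.filter_mem_eq_inter, Finset.univ_inter]
          refine Finset.prod_congr rfl fun c hc => ?_
          rw [if_pos hc, Finset.prod_const, Finset.card_univ]
        have h2 : ∏ c ∈ Finset.univ.filter (fun c : PBond P (j + 1) => ¬ c ∈ S),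
            ∏ _r : {r : Fin P.d → Fin P.L // off r c.dir = 0 ∧ ¬ IsCentral c (r, 1, 1)},
              (if c ∈ S then HaarData.haar {g : G | dist1 g < ρ} else (1 : ENNReal)) = 1 := by
          refine Finset.prod_eq_one fun c hc => ?_
          rw [Finset.mem_filter] at hc
          rw [if_neg hc.2, Finset.prod_const_one]
        rw [h1, h2, mul_one]

/-- … in one exponent: `≤ Haar{dist1 < ρ}^{|S|·(L^{d−1}−1)}`. [cite: Balaban1987RG1, (0.4) p.253 (bookkeeping)] -/
theorem measure_forall_crossLoops_lt_le_pow (hj : j + 1 ≤ P.m + P.K) (ρ : ℝ) (S : Finset (PBond P (j + 1))) :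
    fieldMeasure P j G {U : GaugeField P j G | ∀ c ∈ S, ∀ r : {r : Fin P.d → Fin P.L // off r c.dir = 0 ∧ ¬ IsCentral c (r, 1, 1)},
        dist1 (loopHol U c (r.1, 1, 1)) < ρ} ≤ HaarData.haar {g : G | dist1 g < ρ} ^ (S.card * (P.L ^ (P.d - 1) - 1)) := by
  refine (measure_forall_crossLoops_lt_le_prod hj ρ S).trans_eq ?_
  rw [Finset.prod_congr rfl fun c _ => by rw [card_offsets c], Finset.prod_const, ← pow_mul, mul_comm]

variable (ℰ : LoopAverage G)

/-- ★★ **`dU{U | ∀ c ∈ S, Small ℰ U c} ≤ Π_{c∈S} Haar{dist1 < δ}^{#T_c}`** for every finset `S` of coarse bonds: the small-field guard of a SET of coarse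
bonds asks in particular their `Σ_{c∈S}(L^{d−1} − 1)` crossing loops within `δ` of `1` (part 7B is `|S| = 1`; a union bound cannot give products).
[cite: Balaban1987RG1, (0.4) p.253 (the guard of the typed log; bookkeeping)] -/
theorem measure_forall_small_le_prod (hj : j + 1 ≤ P.m + P.K) (S : Finset (PBond P (j + 1))) :
    fieldMeasure P j G {U : GaugeField P j G | ∀ c ∈ S, Small ℰ U c} ≤
      ∏ c ∈ S, HaarData.haar {g : G | dist1 g < ℰ.δ} ^ Fintype.card {r : Fin P.d → Fin P.L // off r c.dir = 0 ∧ ¬ IsCentral c (r, 1, 1)} := by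
  have hsub : {U : GaugeField P j G | ∀ c ∈ S, Small ℰ U c} ⊆
      {U : GaugeField P j G | ∀ c ∈ S, ∀ r : {r : Fin P.d → Fin P.L // off r c.dir = 0 ∧ ¬ IsCentral c (r, 1, 1)},
        dist1 (loopHol U c (r.1, 1, 1)) < ℰ.δ} := fun U hU c hc r => hU c hc _
  exact (measure_mono hsub).trans (measure_forall_crossLoops_lt_le_prod hj ℰ.δ S)

/-- ★★ **IN ONE EXPONENT: `dU{∀ c ∈ S, Small ℰ · c} ≤ Haar{dist1 < δ}^{|S|·(L^{d−1}−1)}`** — the simultaneous small-field probability of `|S|` coarse bonds is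
the `|S|`-th power of part 7B's one-bond bound. [cite: Balaban1987RG1, (0.4) p.253 (bookkeeping)] -/
theorem measure_forall_small_le_pow (hj : j + 1 ≤ P.m + P.K) (S : Finset (PBond P (j + 1))) :
    fieldMeasure P j G {U : GaugeField P j G | ∀ c ∈ S, Small ℰ U c} ≤ HaarData.haar {g : G | dist1 g < ℰ.δ} ^ (S.card * (P.L ^ (P.d - 1) - 1)) := by
  refine (measure_forall_small_le_prod ℰ hj S).trans_eq ?_
  rw [Finset.prod_congr rfl fun c _ => by rw [card_offsets c], Finset.prod_const, ← pow_mul, mul_comm]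

end Joint

/-! ## §3 At the [B10] slot's averaging on `SU(N)` -/

section Slot

open Literature.MathematicalPhysics.QuantumFieldTheory.Balaban1985CMP102.Setting (Scales)
open Literature.MathematicalPhysics.QuantumFieldTheory.Balaban1983to89.ExpMeanLog (expMeanLogSU expMeanLogSU_δ)
open Literature.MathematicalPhysics.QuantumFieldTheory.Balaban1983to89.Node00 (SU)

variable (N : ℕ) [NeZero N] {L : ℕ}

/-- ★★ **AT THE SLOT**: the simultaneous small-field probability of a set `S` of coarse bonds under the typed guard of the printed exp-mean-log average on
`SU(N)` is at most `Haar_{SU(N)}{‖W − 1‖ < min(1∕3, π∕N)}^{|S|·(L²−1)}` (d = 3), every `N`, standing range. [cite: Balaban1985UV3, (2) p.256; Balaban1987RG1, (0.4) p.253 (bookkeeping)] -/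
theorem measure_forall_small_avOfPrint_le_pow (S₀ : Scales L) {j : ℕ} (hj : j + 1 ≤ S₀.P.m + S₀.P.K) (S : Finset (PBond S₀.P (j + 1))) :
    fieldMeasure S₀.P j (SU N) {U : GaugeField S₀.P j (SU N) | ∀ c ∈ S, Small (expMeanLogSU : LoopAverage (SU N)) U c} ≤
      (HaarData.haar : Measure (SU N)) {g : SU N | dist1 g < min (1 / 3) (Real.pi / N)} ^ (S.card * (S₀.P.L ^ (S₀.P.d - 1) - 1)) := by
  have h := measure_forall_small_le_pow (expMeanLogSU : LoopAverage (SU N)) hj S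
  rwa [expMeanLogSU_δ, Fintype.card_fin] at h

end Slot

end Summit.QuantumFields.YangMills.BalabanUVNodes.N08HaarCompatibilityGuardCrossingJointLaw
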